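import Summits.Ventures.LatticeQCDFlow.Exactness.IMHCommonRandomNumbersSharp
import Summits.Ventures.LatticeQCDFlow.Exactness.IMHCommonRandomNumbersPath
import HarnessLib

/-!
# An exactly unbiased estimator of `π(f)` from two coupled runs: the lag-one common-random-numbers pair makes the
# series of corrections `Σ_{n ≥ k} (f(X′_n) − f(Y_n))` sum, in expectation, to EXACTLY the burn-in bias of `f(Y_k)`

HONEST FRAMING: exact (Metropolis-corrected) sampling algorithms for lattice gauge theory;
figures of merit are autocorrelation/cost numbers at stated couplings and volumes; no
continuum-physics claim.

Venture `LatticeQCDFlow` (cell pub-lqcd), topic `Exactness`; FANOUT row 30 (lean-1, GEN-36).  NEW WORK of the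
cell, general state space.  The common-random-numbers pair chain `K̂` of `K = indepMH q w` (this generation) is run
from an initial coupling `μ̂₀` whose first coordinate is ONE STEP AHEAD of its second (`μ̂₀∘fst⁻¹ = (μ̂₀∘snd⁻¹)K` —
e.g. `Y_0 = x`, `X′_0` one update out of `x` with an independent proposal): the first run `X′_n = Ẑ_n.1` has the law
of `Y_{n+1}`.  With `D_n = f(X′_n) − f(Y_n)` (the printed counterpart — named only, nothing cited — is the unbiased
MCMC estimator `H_k = f(Y_k) + Σ_{n ≥ k} D_n` of Glynn–Rhee ∕ Jacob–O'Leary–Atchadé, here for the exact flow sampler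
with every constant explicit):

* §1 **`crnLag_integral_fst_eq`**, **`crnLag_integral_snd_eq`** — `E f(X′_n) = (μ₂K^{n+1}) f`, `E f(Y_n) = (μ₂Kⁿ) f`
  (`μ₂ = μ̂₀∘snd⁻¹`); **`crnLag_integral_diff_eq`** — `E D_n = (μ₂K^{n+1}) f − (μ₂Kⁿ) f`: the corrections telescope
  in expectation; **`crnLag_integral_abs_diff_le`** — `E|D_n| ≤ rⁿ·(c − a)` (`a ≤ f ≤ c`): they are absolutely
  summable, **`crnLag_summable_integral_abs_diff`**, with total expected work after `k`
  **`crnLag_tsum_integral_abs_diff_le`** `Σ_{n ≥ k} E|D_n| ≤ r^k·(c − a)/A`.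
* §2 **`crnLag_hasSum_integral_diff`** — EXACT UNBIASEDNESS: `Σ_{n ≥ k} E D_n = π(f) − E f(Y_k)` — the expected
  corrections sum EXACTLY to the burn-in bias of the plain estimate `f(Y_k)`, for every `k` and every start;
  **`crnLag_integral_tsum_diff_eq`** — the expectation of the summed corrections equals the sum of their expectations
  (`E[Σ_{n≥k} D_n] = π(f) − E f(Y_k)`, dominated convergence with the geometric envelope), so
  **`crnLag_unbiased`**: `E f(Y_k) + E[Σ_{n ≥ k} D_n] = π(f)` — THE COUPLED ESTIMATOR IS EXACTLY UNBIASED FROM EVERY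
  START, its correction costs `≤ r^k(c − a)/A` in expected absolute size and is a finite sum on the event (probability
  one in the limit, `≥ 1 − r^b` after `b` steps by `…CommonRandomNumbersPath`) that the two runs have merged.
Reading (gauge files): two exact gauge samplers on one stream of proposals and uniforms, one started one update ahead
of the other, give an estimator of every bounded observable with NO burn-in bias at all; the price is the random,
geometrically small correction.
NOT CLAIMED: the variance of `H_k` (finite; not computed here); optimal `k`; anything for unbounded `f`; the a.s.
finiteness of the number of nonzero corrections is the merging theorem of the Path file and is not re-proved here.
No `sorry`, no new definitions, nothing cited as a fact.
-/

noncomputable section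

namespace Summit.Ventures.LatticeQCDFlow.Exactness

open MeasureTheory ProbabilityTheory Function Set Filter
open scoped ENNReal unitInterval Topology
open Summit.Ventures.LatticeQCDFlow.Scoring

variable {Ω : Type*} [MeasurableSpace Ω] {q : Measure Ω} [IsProbabilityMeasure q] {w : Ω → ℝ}

/-! ## §1 The lag-one coupling: marginal expectations and the geometric envelope of the corrections -/

/-- **`E f(Y_n) = (μ₂Kⁿ) f`** on the pair chain (`μ₂ = μ̂₀∘snd⁻¹`), for bounded measurable `f`. [ours] -/
theorem crnLag_integral_snd_eq [Fact (Measurable w)] (hw0 : ∀ y, 0 < w y) (Khat : Kernel (Ω × Ω) (Ω × Ω))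
    [IsMarkovKernel Khat]
    (hK : ∀ z : Ω × Ω, Khat z = (q.prod (volume : Measure unitInterval)).map (fun p : Ω × unitInterval =>
      ((if (p.2 : ℝ) * w z.1 ≤ w p.1 then p.1 else z.1), (if (p.2 : ℝ) * w z.2 ≤ w p.1 then p.1 else z.2))))
    (μ₀ : Measure (Ω × Ω)) [IsProbabilityMeasure μ₀] {f : Ω → ℝ} (hf : Measurable f) {C : ℝ} (hC : ∀ x, |f x| ≤ C)
    (n : ℕ) :
    ∫ z, f ((z n).2) ∂(Kernel.trajMeasure (X := fun _ : ℕ => Ω × Ω) μ₀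
        (fun n : ℕ => Khat.comap (fun h : (i : ↥(Finset.Iic n)) → Ω × Ω => h ⟨n, Finset.mem_Iic.2 le_rfl⟩)
          (measurable_pi_apply _))) =
      ∫ y, f y ∂((fun m : Measure Ω => m.bind (indepMH q w))^[n] (μ₀.map Prod.snd)) := by
  rw [chain_expect_eq_integral_iterate_bind Khat μ₀ (f := fun p : Ω × Ω => f p.2) (hf.comp measurable_snd)
      (fun p => hC p.2) n, ← iterate_bind_crnPair_map_snd Fact.out hw0 Khat hK n μ₀,
    integral_map measurable_snd.aemeasurable hf.aestronglyMeasurable]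

/-- **`E f(X′_n) = (μ₁Kⁿ) f = (μ₂K^{n+1}) f`** under the lag condition `μ₁ = μ₂K`. [ours] -/
theorem crnLag_integral_fst_eq [Fact (Measurable w)] (hw0 : ∀ y, 0 < w y) (Khat : Kernel (Ω × Ω) (Ω × Ω))
    [IsMarkovKernel Khat]
    (hK : ∀ z : Ω × Ω, Khat z = (q.prod (volume : Measure unitInterval)).map (fun p : Ω × unitInterval =>
      ((if (p.2 : ℝ) * w z.1 ≤ w p.1 then p.1 else z.1), (if (p.2 : ℝ) * w z.2 ≤ w p.1 then p.1 else z.2))))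
    (μ₀ : Measure (Ω × Ω)) [IsProbabilityMeasure μ₀]
    (hlag : μ₀.map Prod.fst = (μ₀.map Prod.snd).bind (indepMH q w)) {f : Ω → ℝ} (hf : Measurable f) {C : ℝ}
    (hC : ∀ x, |f x| ≤ C) (n : ℕ) :
    ∫ z, f ((z n).1) ∂(Kernel.trajMeasure (X := fun _ : ℕ => Ω × Ω) μ₀
        (fun n : ℕ => Khat.comap (fun h : (i : ↥(Finset.Iic n)) → Ω × Ω => h ⟨n, Finset.mem_Iic.2 le_rfl⟩)
          (measurable_pi_apply _))) =
      ∫ y, f y ∂((fun m : Measure Ω => m.bind (indepMH q w))^[n + 1] (μ₀.map Prod.snd)) := by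
  rw [chain_expect_eq_integral_iterate_bind Khat μ₀ (f := fun p : Ω × Ω => f p.1) (hf.comp measurable_fst)
      (fun p => hC p.1) n, Function.iterate_succ_apply, ← hlag, ← iterate_bind_crnPair_map_fst Fact.out hw0 Khat hK n μ₀,
    integral_map measurable_fst.aemeasurable hf.aestronglyMeasurable]

/-- **THE CORRECTIONS TELESCOPE IN EXPECTATION**: `E[f(X′_n) − f(Y_n)] = (μ₂K^{n+1}) f − (μ₂Kⁿ) f`. [ours] -/
theorem crnLag_integral_diff_eq [Fact (Measurable w)] (hw0 : ∀ y, 0 < w y) (Khat : Kernel (Ω × Ω) (Ω × Ω))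
    [IsMarkovKernel Khat]
    (hK : ∀ z : Ω × Ω, Khat z = (q.prod (volume : Measure unitInterval)).map (fun p : Ω × unitInterval =>
      ((if (p.2 : ℝ) * w z.1 ≤ w p.1 then p.1 else z.1), (if (p.2 : ℝ) * w z.2 ≤ w p.1 then p.1 else z.2))))
    (μ₀ : Measure (Ω × Ω)) [IsProbabilityMeasure μ₀]
    (hlag : μ₀.map Prod.fst = (μ₀.map Prod.snd).bind (indepMH q w)) {f : Ω → ℝ} (hf : Measurable f) {C : ℝ}
    (hC : ∀ x, |f x| ≤ C) (n : ℕ) :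
    ∫ z, (f ((z n).1) - f ((z n).2)) ∂(Kernel.trajMeasure (X := fun _ : ℕ => Ω × Ω) μ₀
        (fun n : ℕ => Khat.comap (fun h : (i : ↥(Finset.Iic n)) → Ω × Ω => h ⟨n, Finset.mem_Iic.2 le_rfl⟩)
          (measurable_pi_apply _))) =
      ∫ y, f y ∂((fun m : Measure Ω => m.bind (indepMH q w))^[n + 1] (μ₀.map Prod.snd)) -
        ∫ y, f y ∂((fun m : Measure Ω => m.bind (indepMH q w))^[n] (μ₀.map Prod.snd)) := by
  set P := Kernel.trajMeasure (X := fun _ : ℕ => Ω × Ω) μ₀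
        (fun n : ℕ => Khat.comap (fun h : (i : ↥(Finset.Iic n)) → Ω × Ω => h ⟨n, Finset.mem_Iic.2 le_rfl⟩)
          (measurable_pi_apply _)) with hP
  have h1 : Integrable (fun z : ℕ → Ω × Ω => f ((z n).1)) P :=
    integrable_of_bounded P (hf.comp (measurable_fst.comp (measurable_pi_apply n))) (fun z => hC _)
  have h2 : Integrable (fun z : ℕ → Ω × Ω => f ((z n).2)) P :=
    integrable_of_bounded P (hf.comp (measurable_snd.comp (measurable_pi_apply n))) (fun z => hC _)
  rw [integral_sub h1 h2, crnLag_integral_fst_eq hw0 Khat hK μ₀ hlag hf hC n, crnLag_integral_snd_eq hw0 Khat hK μ₀ hf hC n]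

/-- **THE GEOMETRIC ENVELOPE OF THE CORRECTIONS**: `E|f(X′_n) − f(Y_n)| ≤ rⁿ·(c − a)` for `a ≤ f ≤ c`, from every
initial coupling (no lag condition needed). [ours] -/
theorem crnLag_integral_abs_diff_le [Fact (Measurable w)] (hw0 : ∀ y, 0 < w y) {x₀ : Ω} (hmax : ∀ y, w y ≤ w x₀)
    [IsProbabilityMeasure (q.withDensity fun y => ENNReal.ofReal (w y))]
    (Khat : Kernel (Ω × Ω) (Ω × Ω)) [IsMarkovKernel Khat]
    (hK : ∀ z : Ω × Ω, Khat z = (q.prod (volume : Measure unitInterval)).map (fun p : Ω × unitInterval =>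
      ((if (p.2 : ℝ) * w z.1 ≤ w p.1 then p.1 else z.1), (if (p.2 : ℝ) * w z.2 ≤ w p.1 then p.1 else z.2))))
    (μ₀ : Measure (Ω × Ω)) [IsProbabilityMeasure μ₀] {f : Ω → ℝ} (hf : Measurable f) {a c : ℝ}
    (ha : ∀ x, a ≤ f x) (hc : ∀ x, f x ≤ c) (n : ℕ) :
    ∫ z, |f ((z n).1) - f ((z n).2)| ∂(Kernel.trajMeasure (X := fun _ : ℕ => Ω × Ω) μ₀
        (fun n : ℕ => Khat.comap (fun h : (i : ↥(Finset.Iic n)) → Ω × Ω => h ⟨n, Finset.mem_Iic.2 le_rfl⟩)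
          (measurable_pi_apply _))) ≤ (1 - (w x₀)⁻¹) ^ n * (c - a) := by
  have hb : ∀ p : Ω × Ω, |(fun p : Ω × Ω => |f p.1 - f p.2|) p| ≤ c - a := by
    intro p
    dsimp only
    rw [abs_abs]
    have h1 := ha p.1; have h2 := hc p.1; have h3 := ha p.2; have h4 := hc p.2
    exact abs_le.2 ⟨by linarith, by linarith⟩
  rw [chain_expect_eq_integral_iterate_bind Khat μ₀ (f := fun p : Ω × Ω => |f p.1 - f p.2|)
      ((hf.comp measurable_fst).sub (hf.comp measurable_snd)).abs hb n]
  exact integral_iterate_bind_crnPair_abs_sub_le Fact.out hw0 hmax Khat hK n μ₀ hf ha hc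

/-- **THE EXPECTED CORRECTIONS ARE ABSOLUTELY SUMMABLE** (from any `k` on). [ours] -/
theorem crnLag_summable_integral_abs_diff [Fact (Measurable w)] (hw0 : ∀ y, 0 < w y) {x₀ : Ω}
    (hmax : ∀ y, w y ≤ w x₀) [IsProbabilityMeasure (q.withDensity fun y => ENNReal.ofReal (w y))]
    (Khat : Kernel (Ω × Ω) (Ω × Ω)) [IsMarkovKernel Khat]
    (hK : ∀ z : Ω × Ω, Khat z = (q.prod (volume : Measure unitInterval)).map (fun p : Ω × unitInterval =>
      ((if (p.2 : ℝ) * w z.1 ≤ w p.1 then p.1 else z.1), (if (p.2 : ℝ) * w z.2 ≤ w p.1 then p.1 else z.2))))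
    (μ₀ : Measure (Ω × Ω)) [IsProbabilityMeasure μ₀] {f : Ω → ℝ} (hf : Measurable f) {a c : ℝ}
    (ha : ∀ x, a ≤ f x) (hc : ∀ x, f x ≤ c) (k : ℕ) :
    Summable (fun n : ℕ => ∫ z, |f ((z (k + n)).1) - f ((z (k + n)).2)|
      ∂(Kernel.trajMeasure (X := fun _ : ℕ => Ω × Ω) μ₀
        (fun n : ℕ => Khat.comap (fun h : (i : ↥(Finset.Iic n)) → Ω × Ω => h ⟨n, Finset.mem_Iic.2 le_rfl⟩)
          (measurable_pi_apply _)))) := by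
  have hW : 1 ≤ w x₀ := one_le_of_mode (q := q) hmax
  have hr0 : 0 ≤ 1 - (w x₀)⁻¹ := sub_nonneg.2 (inv_le_one_of_one_le₀ hW)
  have hr1 : 1 - (w x₀)⁻¹ < 1 := sub_lt_self _ (inv_pos.mpr (hw0 x₀))
  refine Summable.of_nonneg_of_le (fun n => integral_nonneg fun z => abs_nonneg _)
    (fun n => crnLag_integral_abs_diff_le hw0 hmax Khat hK μ₀ hf ha hc (k + n)) ?_
  have : Summable (fun n : ℕ => (1 - (w x₀)⁻¹) ^ k * (c - a) * (1 - (w x₀)⁻¹) ^ n) :=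
    (summable_geometric_of_lt_one hr0 hr1).mul_left _
  refine this.congr fun n => ?_
  rw [pow_add]; ring

/-- **TOTAL EXPECTED CORRECTION WORK AFTER `k`**: `Σ_{n ≥ 0} E|D_{k+n}| ≤ r^k·(c − a)·w(x₀)` (`= r^k (c − a)/A`). [ours] -/
theorem crnLag_tsum_integral_abs_diff_le [Fact (Measurable w)] (hw0 : ∀ y, 0 < w y) {x₀ : Ω}
    (hmax : ∀ y, w y ≤ w x₀) [IsProbabilityMeasure (q.withDensity fun y => ENNReal.ofReal (w y))]
    (Khat : Kernel (Ω × Ω) (Ω × Ω)) [IsMarkovKernel Khat]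
    (hK : ∀ z : Ω × Ω, Khat z = (q.prod (volume : Measure unitInterval)).map (fun p : Ω × unitInterval =>
      ((if (p.2 : ℝ) * w z.1 ≤ w p.1 then p.1 else z.1), (if (p.2 : ℝ) * w z.2 ≤ w p.1 then p.1 else z.2))))
    (μ₀ : Measure (Ω × Ω)) [IsProbabilityMeasure μ₀] {f : Ω → ℝ} (hf : Measurable f) {a c : ℝ}
    (ha : ∀ x, a ≤ f x) (hc : ∀ x, f x ≤ c) (k : ℕ) :
    ∑' n : ℕ, ∫ z, |f ((z (k + n)).1) - f ((z (k + n)).2)|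
      ∂(Kernel.trajMeasure (X := fun _ : ℕ => Ω × Ω) μ₀
        (fun n : ℕ => Khat.comap (fun h : (i : ↥(Finset.Iic n)) → Ω × Ω => h ⟨n, Finset.mem_Iic.2 le_rfl⟩)
          (measurable_pi_apply _))) ≤ (1 - (w x₀)⁻¹) ^ k * (c - a) * w x₀ := by
  have hW : 1 ≤ w x₀ := one_le_of_mode (q := q) hmax
  have hWpos : 0 < w x₀ := hw0 x₀
  have hr0 : 0 ≤ 1 - (w x₀)⁻¹ := sub_nonneg.2 (inv_le_one_of_one_le₀ hW)
  have hr1 : 1 - (w x₀)⁻¹ < 1 := sub_lt_self _ (inv_pos.mpr hWpos)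
  have hgeo : HasSum (fun n : ℕ => (1 - (w x₀)⁻¹) ^ k * (c - a) * (1 - (w x₀)⁻¹) ^ n)
      ((1 - (w x₀)⁻¹) ^ k * (c - a) * (1 - (1 - (w x₀)⁻¹))⁻¹) :=
    (hasSum_geometric_of_lt_one hr0 hr1).mul_left _
  have hsum : (1 - (1 - (w x₀)⁻¹))⁻¹ = w x₀ := by rw [sub_sub_cancel, inv_inv]
  rw [hsum] at hgeo
  refine (Summable.tsum_le_tsum (fun n => ?_) (crnLag_summable_integral_abs_diff hw0 hmax Khat hK μ₀ hf ha hc k)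
    hgeo.summable).trans_eq hgeo.tsum_eq
  have h := crnLag_integral_abs_diff_le hw0 hmax Khat hK μ₀ hf ha hc (k + n)
  rw [pow_add] at h
  linarith [h]

/-! ## §2 Exact unbiasedness -/

/-- **EXACT UNBIASEDNESS: THE EXPECTED CORRECTIONS SUM TO THE BURN-IN BIAS.**  `w` measurable (a `Fact`), positive,
normalised, maximal at `x₀`; `K̂` a CRN pair kernel; the initial coupling one step ahead in its first coordinate
(`μ̂₀∘fst⁻¹ = (μ̂₀∘snd⁻¹)K`); `a ≤ f ≤ c` measurable.  Then for every `k`: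
`Σ_{n ≥ 0} E[f(X′_{k+n}) − f(Y_{k+n})] = π(f) − E f(Y_k)` (a convergent series with the displayed sum). [ours] -/
theorem crnLag_hasSum_integral_diff [Fact (Measurable w)] (hw0 : ∀ y, 0 < w y) {x₀ : Ω} (hmax : ∀ y, w y ≤ w x₀)
    [IsProbabilityMeasure (q.withDensity fun y => ENNReal.ofReal (w y))]
    (Khat : Kernel (Ω × Ω) (Ω × Ω)) [IsMarkovKernel Khat]
    (hK : ∀ z : Ω × Ω, Khat z = (q.prod (volume : Measure unitInterval)).map (fun p : Ω × unitInterval =>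
      ((if (p.2 : ℝ) * w z.1 ≤ w p.1 then p.1 else z.1), (if (p.2 : ℝ) * w z.2 ≤ w p.1 then p.1 else z.2))))
    (μ₀ : Measure (Ω × Ω)) [IsProbabilityMeasure μ₀]
    (hlag : μ₀.map Prod.fst = (μ₀.map Prod.snd).bind (indepMH q w)) {f : Ω → ℝ} (hf : Measurable f) {a c : ℝ}
    (ha : ∀ x, a ≤ f x) (hc : ∀ x, f x ≤ c) (k : ℕ) :
    HasSum (fun n : ℕ => ∫ z, (f ((z (k + n)).1) - f ((z (k + n)).2))
        ∂(Kernel.trajMeasure (X := fun _ : ℕ => Ω × Ω) μ₀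
          (fun n : ℕ => Khat.comap (fun h : (i : ↥(Finset.Iic n)) → Ω × Ω => h ⟨n, Finset.mem_Iic.2 le_rfl⟩)
            (measurable_pi_apply _))))
      (∫ x, f x ∂(q.withDensity fun y => ENNReal.ofReal (w y)) -
        ∫ z, f ((z k).2) ∂(Kernel.trajMeasure (X := fun _ : ℕ => Ω × Ω) μ₀
          (fun n : ℕ => Khat.comap (fun h : (i : ↥(Finset.Iic n)) → Ω × Ω => h ⟨n, Finset.mem_Iic.2 le_rfl⟩)
            (measurable_pi_apply _)))) := by
  haveI : IsProbabilityMeasure (μ₀.map Prod.snd) := Measure.isProbabilityMeasure_map measurable_snd.aemeasurable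
  set π : Measure Ω := q.withDensity fun y => ENNReal.ofReal (w y) with hπ
  set μ₂ : Measure Ω := μ₀.map Prod.snd with hμ₂
  -- the marginal expectations `u N = (μ₂K^N) f`
  set u : ℕ → ℝ := fun N => ∫ y, f y ∂((fun m : Measure Ω => m.bind (indepMH q w))^[N] μ₂) with hu
  have hC : ∀ x, |f x| ≤ max |a| |c| := fun x => abs_le_max_abs_abs (ha x) (hc x)
  have hterm : ∀ n, ∫ z, (f ((z (k + n)).1) - f ((z (k + n)).2))
      ∂(Kernel.trajMeasure (X := fun _ : ℕ => Ω × Ω) μ₀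
        (fun n : ℕ => Khat.comap (fun h : (i : ↥(Finset.Iic n)) → Ω × Ω => h ⟨n, Finset.mem_Iic.2 le_rfl⟩)
          (measurable_pi_apply _))) = u (k + n + 1) - u (k + n) := fun n =>
    crnLag_integral_diff_eq hw0 Khat hK μ₀ hlag hf hC (k + n)
  have hYk : ∫ z, f ((z k).2) ∂(Kernel.trajMeasure (X := fun _ : ℕ => Ω × Ω) μ₀
        (fun n : ℕ => Khat.comap (fun h : (i : ↥(Finset.Iic n)) → Ω × Ω => h ⟨n, Finset.mem_Iic.2 le_rfl⟩)
          (measurable_pi_apply _))) = u k := crnLag_integral_snd_eq hw0 Khat hK μ₀ hf hC k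
  simp_rw [hterm]
  rw [hYk]
  -- `u N → π f` (any-start envelope `|u N − π f| ≤ r^N (c − a)`)
  have hW : 1 ≤ w x₀ := one_le_of_mode (q := q) hmax
  have hr0 : 0 ≤ 1 - (w x₀)⁻¹ := sub_nonneg.2 (inv_le_one_of_one_le₀ hW)
  have hr1 : 1 - (w x₀)⁻¹ < 1 := sub_lt_self _ (inv_pos.mpr (hw0 x₀))
  have hlim : Tendsto u atTop (𝓝 (∫ x, f x ∂π)) := by
    have hgeom : Tendsto (fun N : ℕ => (1 - (w x₀)⁻¹) ^ N * (c - a)) atTop (𝓝 (0 * (c - a))) :=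
      (tendsto_pow_atTop_nhds_zero_of_lt_one hr0 hr1).mul_const _
    rw [zero_mul] at hgeom
    refine tendsto_iff_norm_sub_tendsto_zero.2 (squeeze_zero (fun N => norm_nonneg _) (fun N => ?_) hgeom)
    rw [Real.norm_eq_abs]
    haveI := isProbabilityMeasure_iterate_bind (κ := indepMH q w) μ₂ N
    exact integral_iterate_bind_indepMH_abs_le (q := q) Fact.out hw0 hmax N μ₂ hf ha hc
  -- the telescoping partial sums and the absolutely convergent series
  have hpartial : ∀ N, ∑ n ∈ Finset.range N, (u (k + n + 1) - u (k + n)) = u (k + N) - u k := by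
    intro N
    have := Finset.sum_range_sub (fun n => u (k + n)) N
    simpa [Nat.add_assoc] using this
  have hsumm : Summable (fun n : ℕ => u (k + n + 1) - u (k + n)) := by
    refine Summable.of_norm_bounded (g := fun n : ℕ => ∫ z, |f ((z (k + n)).1) - f ((z (k + n)).2)|
      ∂(Kernel.trajMeasure (X := fun _ : ℕ => Ω × Ω) μ₀
        (fun n : ℕ => Khat.comap (fun h : (i : ↥(Finset.Iic n)) → Ω × Ω => h ⟨n, Finset.mem_Iic.2 le_rfl⟩)
          (measurable_pi_apply _)))) (crnLag_summable_integral_abs_diff hw0 hmax Khat hK μ₀ hf ha hc k) (fun n => ?_)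
    rw [← hterm n, Real.norm_eq_abs]
    exact abs_integral_le_integral_abs
  have hlim2 : Tendsto (fun N => ∑ n ∈ Finset.range N, (u (k + n + 1) - u (k + n))) atTop
      (𝓝 (∫ x, f x ∂π - u k)) := by
    simp_rw [hpartial]
    have hshift : Tendsto (fun N => u (k + N)) atTop (𝓝 (∫ x, f x ∂π)) :=
      hlim.comp (tendsto_atTop_atTop_of_monotone (fun _ _ h => Nat.add_le_add_left h k)
        fun N => ⟨N, Nat.le_add_left N k⟩)
    exact hshift.sub_const (u k)
  have heq : ∑' n, (u (k + n + 1) - u (k + n)) = ∫ x, f x ∂π - u k :=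
    tendsto_nhds_unique hsumm.hasSum.tendsto_sum_nat hlim2
  rw [← heq]
  exact hsumm.hasSum

/-- **THE EXPECTATION OF THE SUMMED CORRECTIONS IS THE SUM OF THEIR EXPECTATIONS** (dominated convergence with the
geometric envelope): `E[Σ_{n ≥ 0} (f(X′_{k+n}) − f(Y_{k+n}))] = π(f) − E f(Y_k)`. [ours] -/
theorem crnLag_integral_tsum_diff_eq [Fact (Measurable w)] (hw0 : ∀ y, 0 < w y) {x₀ : Ω} (hmax : ∀ y, w y ≤ w x₀)
    [IsProbabilityMeasure (q.withDensity fun y => ENNReal.ofReal (w y))]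
    (Khat : Kernel (Ω × Ω) (Ω × Ω)) [IsMarkovKernel Khat]
    (hK : ∀ z : Ω × Ω, Khat z = (q.prod (volume : Measure unitInterval)).map (fun p : Ω × unitInterval =>
      ((if (p.2 : ℝ) * w z.1 ≤ w p.1 then p.1 else z.1), (if (p.2 : ℝ) * w z.2 ≤ w p.1 then p.1 else z.2))))
    (μ₀ : Measure (Ω × Ω)) [IsProbabilityMeasure μ₀]
    (hlag : μ₀.map Prod.fst = (μ₀.map Prod.snd).bind (indepMH q w)) {f : Ω → ℝ} (hf : Measurable f) {a c : ℝ}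
    (ha : ∀ x, a ≤ f x) (hc : ∀ x, f x ≤ c) (k : ℕ) :
    ∫ z, (∑' n : ℕ, (f ((z (k + n)).1) - f ((z (k + n)).2)))
        ∂(Kernel.trajMeasure (X := fun _ : ℕ => Ω × Ω) μ₀
          (fun n : ℕ => Khat.comap (fun h : (i : ↥(Finset.Iic n)) → Ω × Ω => h ⟨n, Finset.mem_Iic.2 le_rfl⟩)
            (measurable_pi_apply _))) =
      ∫ x, f x ∂(q.withDensity fun y => ENNReal.ofReal (w y)) -
        ∫ z, f ((z k).2) ∂(Kernel.trajMeasure (X := fun _ : ℕ => Ω × Ω) μ₀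
          (fun n : ℕ => Khat.comap (fun h : (i : ↥(Finset.Iic n)) → Ω × Ω => h ⟨n, Finset.mem_Iic.2 le_rfl⟩)
            (measurable_pi_apply _))) := by
  set P := Kernel.trajMeasure (X := fun _ : ℕ => Ω × Ω) μ₀
        (fun n : ℕ => Khat.comap (fun h : (i : ↥(Finset.Iic n)) → Ω × Ω => h ⟨n, Finset.mem_Iic.2 le_rfl⟩)
          (measurable_pi_apply _)) with hP
  have hC : ∀ x, |f x| ≤ max |a| |c| := fun x => abs_le_max_abs_abs (ha x) (hc x)
  have hDm : ∀ n, Measurable (fun z : ℕ → Ω × Ω => f ((z (k + n)).1) - f ((z (k + n)).2)) := fun n =>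
    (hf.comp (measurable_fst.comp (measurable_pi_apply _))).sub (hf.comp (measurable_snd.comp (measurable_pi_apply _)))
  have hDb : ∀ n (z : ℕ → Ω × Ω), |f ((z (k + n)).1) - f ((z (k + n)).2)| ≤ c - a := by
    intro n z
    have h1 := ha ((z (k + n)).1); have h2 := hc ((z (k + n)).1)
    have h3 := ha ((z (k + n)).2); have h4 := hc ((z (k + n)).2)
    exact abs_le.2 ⟨by linarith, by linarith⟩
  have hDi : ∀ n, Integrable (fun z : ℕ → Ω × Ω => f ((z (k + n)).1) - f ((z (k + n)).2)) P := fun n =>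
    integrable_of_bounded P (hDm n) (hDb n)
  have hsum : Summable (fun n => ∫ z, ‖f ((z (k + n)).1) - f ((z (k + n)).2)‖ ∂P) := by
    simp_rw [Real.norm_eq_abs]
    exact crnLag_summable_integral_abs_diff hw0 hmax Khat hK μ₀ hf ha hc k
  rw [← integral_tsum_of_summable_integral_norm hDi hsum]
  exact (crnLag_hasSum_integral_diff hw0 hmax Khat hK μ₀ hlag hf ha hc k).tsum_eq

/-- **THE COUPLED ESTIMATOR IS EXACTLY UNBIASED FROM EVERY START**: `E f(Y_k) + E[Σ_{n ≥ 0}(f(X′_{k+n}) − f(Y_{k+n}))]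
= π(f)`. [ours] -/
theorem crnLag_unbiased [Fact (Measurable w)] (hw0 : ∀ y, 0 < w y) {x₀ : Ω} (hmax : ∀ y, w y ≤ w x₀)
    [IsProbabilityMeasure (q.withDensity fun y => ENNReal.ofReal (w y))]
    (Khat : Kernel (Ω × Ω) (Ω × Ω)) [IsMarkovKernel Khat]
    (hK : ∀ z : Ω × Ω, Khat z = (q.prod (volume : Measure unitInterval)).map (fun p : Ω × unitInterval =>
      ((if (p.2 : ℝ) * w z.1 ≤ w p.1 then p.1 else z.1), (if (p.2 : ℝ) * w z.2 ≤ w p.1 then p.1 else z.2))))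
    (μ₀ : Measure (Ω × Ω)) [IsProbabilityMeasure μ₀]
    (hlag : μ₀.map Prod.fst = (μ₀.map Prod.snd).bind (indepMH q w)) {f : Ω → ℝ} (hf : Measurable f) {a c : ℝ}
    (ha : ∀ x, a ≤ f x) (hc : ∀ x, f x ≤ c) (k : ℕ) :
    ∫ z, f ((z k).2) ∂(Kernel.trajMeasure (X := fun _ : ℕ => Ω × Ω) μ₀
          (fun n : ℕ => Khat.comap (fun h : (i : ↥(Finset.Iic n)) → Ω × Ω => h ⟨n, Finset.mem_Iic.2 le_rfl⟩)
            (measurable_pi_apply _))) +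
      ∫ z, (∑' n : ℕ, (f ((z (k + n)).1) - f ((z (k + n)).2)))
        ∂(Kernel.trajMeasure (X := fun _ : ℕ => Ω × Ω) μ₀
          (fun n : ℕ => Khat.comap (fun h : (i : ↥(Finset.Iic n)) → Ω × Ω => h ⟨n, Finset.mem_Iic.2 le_rfl⟩)
            (measurable_pi_apply _))) =
      ∫ x, f x ∂(q.withDensity fun y => ENNReal.ofReal (w y)) := by
  rw [crnLag_integral_tsum_diff_eq hw0 hmax Khat hK μ₀ hlag hf ha hc k]
  ring

/-- **FROM A SINGLE CONFIGURATION `x`**: start `Y` at `x` and `X′` one independent update out of `x`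
(`μ̂₀ = (δ_x K) ⊗ δ_x`), then couple by common random numbers: `E f(Y_k) + E[Σ_{n ≥ 0}(f(X′_{k+n}) − f(Y_{k+n}))] =
π(f)` — an exactly unbiased estimate of `π(f)` from every starting configuration, for every `k`. [ours] -/
theorem crnLag_unbiased_dirac [Fact (Measurable w)] (hw0 : ∀ y, 0 < w y) {x₀ : Ω} (hmax : ∀ y, w y ≤ w x₀)
    [IsProbabilityMeasure (q.withDensity fun y => ENNReal.ofReal (w y))]
    (Khat : Kernel (Ω × Ω) (Ω × Ω)) [IsMarkovKernel Khat]
    (hK : ∀ z : Ω × Ω, Khat z = (q.prod (volume : Measure unitInterval)).map (fun p : Ω × unitInterval =>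
      ((if (p.2 : ℝ) * w z.1 ≤ w p.1 then p.1 else z.1), (if (p.2 : ℝ) * w z.2 ≤ w p.1 then p.1 else z.2))))
    (x : Ω) {f : Ω → ℝ} (hf : Measurable f) {a c : ℝ} (ha : ∀ x, a ≤ f x) (hc : ∀ x, f x ≤ c) (k : ℕ) :
    ∫ z, f ((z k).2) ∂(Kernel.trajMeasure (X := fun _ : ℕ => Ω × Ω)
          (((Measure.dirac x).bind (indepMH q w)).prod (Measure.dirac x))
          (fun n : ℕ => Khat.comap (fun h : (i : ↥(Finset.Iic n)) → Ω × Ω => h ⟨n, Finset.mem_Iic.2 le_rfl⟩)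
            (measurable_pi_apply _))) +
      ∫ z, (∑' n : ℕ, (f ((z (k + n)).1) - f ((z (k + n)).2)))
        ∂(Kernel.trajMeasure (X := fun _ : ℕ => Ω × Ω)
          (((Measure.dirac x).bind (indepMH q w)).prod (Measure.dirac x))
          (fun n : ℕ => Khat.comap (fun h : (i : ↥(Finset.Iic n)) → Ω × Ω => h ⟨n, Finset.mem_Iic.2 le_rfl⟩)
            (measurable_pi_apply _))) =
      ∫ x, f x ∂(q.withDensity fun y => ENNReal.ofReal (w y)) := by
  haveI h1 : IsProbabilityMeasure ((Measure.dirac x).bind (indepMH q w)) :=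
    ⟨by rw [Measure.bind_apply MeasurableSet.univ (Kernel.aemeasurable _)]; simp⟩
  have hlag : (((Measure.dirac x).bind (indepMH q w)).prod (Measure.dirac x)).map Prod.fst =
      ((((Measure.dirac x).bind (indepMH q w)).prod (Measure.dirac x)).map Prod.snd).bind (indepMH q w) := by
    rw [Measure.map_fst_prod, Measure.map_snd_prod, measure_univ, measure_univ, one_smul, one_smul]
  exact crnLag_unbiased hw0 hmax Khat hK _ hlag hf ha hc k

end Summit.Ventures.LatticeQCDFlow.Exactness

end
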